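import Literature.MathematicalPhysics.QuantumFieldTheory.Balaban1983to89.B2Eq218Translation
import Literature.MathematicalPhysics.QuantumFieldTheory.Balaban1983to89.HiggsCondCov232
import Literature.MathematicalPhysics.QuantumFieldTheory.Balaban1983to89.B1Eq116PrimeOperation

/-!
# Bałaban, *(Higgs)₂,₃ quantum fields in a finite volume II*, CMP **86** (1982), (2.18)–(2.19) pp. 560–561:
# r02's schematic `B2Eq218Translation` INSTANTIATED on the concrete (Higgs)₂,₃ carrier — the translation
# `A = A′ + aL⁻²C^{(0)}_{Λ₀}Q*B` with the VECTOR-field covariances `C^{(0)}`, `C^{(0)}_{Λ₀}` of Chap. I.2 / (I.3.10)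

statement-level skeleton of published theorems with citation tags; proofs where landed; nothing here is a claim about the Yang–Mills mass gap

CITATION HEADER.  T. Bałaban, *(Higgs)₂,₃ quantum fields in a finite volume. II. An upper bound*, Commun. Math. Phys.
**86** (1982) 555–594 [Balaban1982Higgs2] (cell paper B2; PDF held `paper:balaban1982-cmp86-higgs23-ii`, journal page =
PDF page + 554; pp. 560–561 read AS IMAGES on the ×2 renders `run/shared/lean/pub/pub-balaban/b2b-balaban-ref1/pages/
1982-cmp86-higgs23-II/1982-cmp86-higgs23-II-p006-x2.png`, `…-p007-x2.png`), and part I, *I. A lower bound*, Commun. Math.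
Phys. **85** (1982) 603–626 [Balaban1982Higgs1] (p. 608 and (3.10)–(3.11) p. 614 on `…/1982-cmp85-higgs23-I/…-p006-x2.png`,
`…-p012-x2.png`).  Unit `lit-balaban-r14` gen 23 (literature-prover-lit-balaban-r14-g23-0; B1 reader, B2 second reader;
HOME `run/shared/lean/pub/lit-balaban/`).  SKELETON row served: **B2.Eq2.18** (owner r02) — the OWED MEMBER named in r02's
reading-rule audit `lit-balaban-r02/READING-RULE-AUDIT-B2-g50.md` §3.2: *"ONE instance — `transl218`/`eq219` at X := `PBond
P 0` (× components), Y := coarse bonds, `blk` := `blockOf`, C := the level-0 vector-field fluctuation covariance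
(−Δ^ε + μ₀² + aL⁻²Q*Q)⁻¹ of (I.3.10) on `HiggsLattice` and CΛ := its Dirichlet-conditioned version outside Λ₀
(`condCov232`-type construction at A = 0), with the support facts DISCHARGED"*; it also gives r12's row B1.Eq3.10 ((I.3.10),
`B1Sect3Statements.transl310`) its concrete instance (`transl218C_univ`, `transl218C_eq_transl310`).

WHAT IS PRINTED (verbatim).  II p. 560 [PDF 6]: *"Now we will make a translation in the fields A analogous to the
translation (I.3.10) in the proof of the lower bound, only now it is connected with a conditional integral, the conditioning
in the set Λ₀ᶜ. Thus we make a translation  A = A′ + aL⁻²C^{(0)}_{Λ₀}Q*B, (2.18)  where C^{(0)}_{Λ₀} denotes the covariance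
with the Dirichlet boundary conditions outside Λ₀ introduced in Chap. I.2. Its properties were described in Proposition
I.2.3. … To define this division let us introduce a function θ₁ equal to 1 on Λ₂ and changing smoothly from 1 to 0 on a
slice of thickness < M surrounding Λ₂. We have
A = [(1 − θ₁)(A′ + aL⁻²C^{(0)}_{Λ₀}Q*B) + θ₁aL⁻²ζC^{(0)}Q*B] + θ₁(A′ + aL⁻²δC^{(0)}_{Λ₀}Q*B + aL⁻²(1 − ζ)C^{(0)}Q*Λ′₀B)
=: B̃^{(1)} + A″, (2.19)"*; p. 561 [PDF 7]: *"where ζC^{(0)}Q* denotes an operator with the kernel (ζC^{(0)}Q*)(x, y) =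
ζ(x, y)L^{−d} Σ_{x′∈B(y)} C^{(0)}(x, x′), x ∈ T₁, y ∈ T′₁, and the function ζ is determined by the conditions: ζ(x, y) = 1
if |x − y| ≦ ½r(ε), ζ(x, y) = 0 if |x − y| > ½r(ε)."*  I p. 614 [PDF 12]: *"The next step is the translation in the fields
A  A = A′ + aL⁻²C^{(0)}Q*B =: A′ + B^{(1)} (3.10)  separating the quadratic form in the fields A, B in (3.7) into a sum of
two forms  ½⟨B, Δ^{(1),L}B⟩ + ½(aL^{d−2}Σ_{y∈T′₁}|(QA′)(y)|² + ⟨A′, (−Δ + μ₀²ε²)A′⟩) = ½⟨B, Δ^{(1),L}B⟩ + ½⟨A′, (C^{(0)})⁻¹A′⟩.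
(3.11)"*; I p. 608 [PDF 6]: *"The renormalization transformations for vector fields will be obtained by taking N = d and an
external vector field A = 0, so we will not consider them separately."*; I p. 611 (2.32): *"C^{(k)}_Λ(Ω, A) = ((aL^{−2}P(A) +
Δ^{(k)}(Ω, A))↾_Λ)^{−1}"*, (2.35): *"δC^{(k)}_Λ(Ω, A) = C^{(k)}_Λ(Ω, A) − C^{(k)}(Ω, A)"*.

THE INSTANCE (all objects of record BY NAME, nothing restated).  r02's `B2Eq218Translation` (p246645) types (2.18)/(2.19)
over schematic coordinates: index types `X` (components of the vector field on `T₁`), `Y` (of the block field on `T′₁`),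
the block map `blk`, the weight `w` of `Q*`, the coefficient `c`, and the covariances `C`, `CΛ : Matrix X X ℝ` constrained
only by the support fact `hCΛ` of `eq219`.  Here, at level `0` of the typer's lattice family `P` (`HiggsLattice`; the unit
lattice of II §2 / I (3.7) is the family `P.unitAt 0`, `coeff_unitAt`):
* `X := PBond P 0` — so that r02's `X → ℝ` IS `HiggsLattice.VecField P 0` —, `Y := PBond P 1`, `blk b := ⟨blockOf b₋, μ⟩`
  (`blk`), `c := a·(P.mesh 1)⁻²` (`= aL⁻²` on the unit lattice), and **`w := 1`**: print's `Q*` is the adjoint of the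
  block averaging `Q` for the scalar products (I.1.5) of `T₁` (weight 1) and `T′₁` (weight `L^d`, I (1.21)) — this is what
  makes (I.3.11) complete the square, `aL^{d−2}Σ_y|(QA′)(y)|² = aL⁻²⟨A′, Q*QA′⟩` — i.e. `(Q*B)(x) = B(y_x)`, the typer's
  `B1Eq27StepAdjoint.avgQAdjLin` (adjointness PROVED there, `siteInner_avgQLin`) at the trivial coupling
  (`toSite_pullback_eq_avgQAdjLin`); the factor `L^{−d}` of the p. 561 kernel display is the weight of the `T′₁`-sum a
  kernel on `T₁ × T′₁` is integrated against, so in the unweighted `Matrix.mulVec` coordinates of `B2Eq218Translation` the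
  same operator has `w = 1` (`zetaCQ_one_mulVec`: `(ζC^{(0)}Q*B)(x) = Σ_y ζ(x,y) Σ_{x′∈B(y)} C^{(0)}(x,x′) B(y)`, print's
  display summed over `y ∈ T′₁` with its weight);
* **`C := covMat P msq a`** = the bond-coordinate matrix (`vecMat` = `LinearMap.toMatrix'` through the typer's identification
  `B3MultiscaleFields.toSite/ofSite` of vector fields with `ℝ^d`-valued site functions, p. 608) of the level-0 VECTOR-field
  covariance `B1Eq230FluctCov.fluctCovA (zeroCharge d) T 0 msq a 0` = `HiggsFluctMeasure.fluctCov P msq a 0`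
  (`covMat_eq_fluctCov`) = `(a(Lε)⁻²Q*Q + (−Δ^ε + msq))⁻¹` — (I.3.10)/(I.3.11)'s `C^{(0)}` with `msq` ↤ μ₀² (ε-lattice) resp.
  μ₀²ε² (unit lattice);
* **`CΛ := condCovMat P msq a Λ₀`** = the matrix of the typer's `HiggsCondCov232.condCov232 (zeroCharge d) T 0 msq a 0 Λ₀`,
  (I.2.32) at `N = d`, `A = 0`: *"the covariance with the Dirichlet boundary conditions outside Λ₀ introduced in Chap. I.2"*
  (`condCovMat_univ`: at `Λ₀ = T₁` it is `C`); its existence/inverse identities/symmetry/positivity are the typer's theorems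
  (`isUnit_padOp_precOpA`, `restrictOp_precOpA_mul_condCov232`, … at `N := d`), `m²` ↦ `μ₀² > 0` (I p. 605);
* the SUPPORT FACTS of `eq219` DISCHARGED: **`condCovMat_support`** (`CΛ b b′ ≠ 0 → b₋ ∈ Λ₀ ∧ b′₋ ∈ Λ₀`, from
  `condCov232_apply_of_not_mem` / `condCov232_cutTo`), `mem_bondsOver_blockSet_iff` (`hblk` for `Λ₀ = B(Λ′₀)`, I (1.18));
  r02's `deltaC` (δC^{(0)}_{Λ₀} on Λ₀ × Λ₀) IS the matrix of `(δC)↾_{Λ₀}` for the typer's (I.2.35) `deltaCov235`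
  (**`deltaC_eq_vecMat_restrictOp_deltaCov235`**);
* **`transl218C`** = (2.18) written with the concrete operators (`A′ + a(Lε)⁻²·C^{(0)}_{Λ₀}(Q*B)` as vector fields) and
  **`transl218C_eq`**: it IS r02's `transl218 c 1 CΛ blk A′ B` (hence r12's `transl310`, `transl218C_eq_transl310`);
  **`eq219_concrete`**: (2.19) `A = B̃^{(1)} + A″` ON THE CARRIER (r02's `btilde`/`adprime` at the instance) for every
  `θ₁ : T₁ → ℝ` supported in `Λ₀` at sup-distance (I.1.3) `> ½r` from `Λ₀ᶜ` and `ζ = zetaOfDist` of `|x − y|`, `y ∈ T′₁ ⊂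
  T₁` (`HiggsLattice.emb`), by r02's `eq219` + `zeta_reach_of_dist` (print: supp θ₁ ⊂ the M-slice around Λ₂ ⊂ Λ₁, at
  distance > r(ε) − M > ½r(ε) from Λ₀ᶜ by (2.8)).
HONEST SCOPE.  (a) Level `0` of the `ε`-lattice family (`c = a(Lε)⁻²`, mass `msq` free; the unit-lattice letters of print
are the family `P.unitAt 0`); (b) `Λ₀` is ANY union of `L`-blocks `B(Λ′₀)` (print: a union of LARGE blocks, (2.7)) and the
Dirichlet conditioning sets the `d` components `A(⟨x, x+e_μ⟩)`, `x ∉ Λ₀`, to zero (the `N = d` reading of p. 608);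
(c) the conditional-INTEGRAL meaning of (2.18) (mean of the conditional Gaussian of (2.28)/(2.45); rows B2.Eq2.28/2.44) and
the smallness of `A′`, `A″` (Sect. 3) are NOT asserted — bookkeeping and finite-dimensional linear algebra only; (d) `θ₁`,
`r` are free data with the two printed support properties as hypotheses.  No `Prop`-valued definition, no `sorry`.
-/

open scoped BigOperators Classical

namespace Literature.MathematicalPhysics.QuantumFieldTheory.Balaban1983to89.B2Eq218Concrete

open Matrix HiggsLattice B3MultiscaleFields B1Eq230FluctCov HiggsCondCov232 B2Eq255Concrete B1Eq27StepAdjoint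
  B2Eq218Translation

noncomputable section

variable {P : HiggsLattice.Params}

/-! ## §1 Bond coordinates: `X = T*₁`, `Y = T*′₁`, the block map, operators on vector fields as matrices -/

/-- The block map on COMPONENTS: the bond `⟨x, x + εe_μ⟩` of `T₁` goes to the bond `⟨y_x, y_x + Lεe_μ⟩` of `T′₁`
(`y_x` = `HiggsLattice.blockOf x`, I (1.17)) — r02's `blk : X → Y` (*"x ∈ B(y) ⇔ blk x = y, componentwise"*).
[cite: Balaban1982Higgs2, (2.18) p.560] -/
def blk (b : HiggsLattice.PBond P 0) : HiggsLattice.PBond P 1 := ⟨HiggsLattice.blockOf b.src, b.dir⟩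

/-- The block bond starts at the block point. [cite: Balaban1982Higgs2, (2.18) p.560] -/
@[simp] theorem blk_src (b : HiggsLattice.PBond P 0) : (blk b).src = HiggsLattice.blockOf b.src := rfl

/-- The block bond keeps the direction. [cite: Balaban1982Higgs2, (2.18) p.560] -/
@[simp] theorem blk_dir (b : HiggsLattice.PBond P 0) : (blk b).dir = b.dir := rfl

/-- The components over a set of sites: the bonds `⟨x, x + ηe_μ⟩`, `x ∈ Λ`, `μ = 1, …, d` (r02's `Λ₀ : Finset X`,
`Λ₀' : Finset Y` for the site sets Λ₀ ⊂ T₁, Λ′₀ ⊂ T′₁). [cite: Balaban1982Higgs2, (2.19) p.560] -/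
def bondsOver {j : ℕ} (Λ : Finset (HiggsLattice.Site P j)) : Finset (HiggsLattice.PBond P j) :=
  Finset.univ.filter fun b => b.src ∈ Λ

/-- Membership in `bondsOver`. [cite: Balaban1982Higgs2, (2.19) p.560] -/
@[simp] theorem mem_bondsOver {j : ℕ} (Λ : Finset (HiggsLattice.Site P j)) (b : HiggsLattice.PBond P j) :
    b ∈ bondsOver Λ ↔ b.src ∈ Λ := by
  simp [bondsOver]

/-- **`hblk` of `eq219` on the carrier**: for `Λ₀ = B(Λ′₀)` (I (1.18), `HiggsLattice.blockSet`) a component lies over Λ₀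
iff its block component lies over Λ′₀. [cite: Balaban1982Higgs2, (2.19) p.560] -/
theorem mem_bondsOver_blockSet_iff (Λ₀' : Finset (HiggsLattice.Site P 1)) (b : HiggsLattice.PBond P 0) :
    b ∈ bondsOver (HiggsLattice.blockSet Λ₀') ↔ blk b ∈ bondsOver Λ₀' := by
  rw [mem_bondsOver, mem_bondsOver, blk_src, HiggsLattice.mem_blockSet]

/-- The typer's identification of vector fields with `ℝ^d`-valued site functions (`B3MultiscaleFields.toSite/ofSite`,
I p. 608 *"N = d"*) as a linear equivalence. [cite: Balaban1982Higgs1, p.608] -/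
def siteEquiv (P : HiggsLattice.Params) (j : ℕ) : HiggsLattice.VecField P j ≃ₗ[ℝ] ScalarField P j P.d where
  toFun := toSite
  invFun := ofSite
  map_add' := toSite_add
  map_smul' c A := by
    funext x
    rfl
  left_inv := ofSite_toSite
  right_inv := toSite_ofSite

/-- `siteEquiv` is `toSite`. [cite: Balaban1982Higgs1, p.608] -/
@[simp] theorem siteEquiv_apply (j : ℕ) (A : HiggsLattice.VecField P j) : siteEquiv P j A = toSite A := rfl

/-- `siteEquiv.symm` is `ofSite`. [cite: Balaban1982Higgs1, p.608] -/
@[simp] theorem siteEquiv_symm_apply (j : ℕ) (f : ScalarField P j P.d) : (siteEquiv P j).symm f = ofSite f := rfl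

/-- An operator on the `ℝ^d`-valued site functions of `T₁`, transported to the vector fields (bond functions).
[cite: Balaban1982Higgs1, p.608] -/
def onVec (G : Module.End ℝ (ScalarField P 0 P.d)) : Module.End ℝ (HiggsLattice.VecField P 0) :=
  (siteEquiv P 0).symm.toLinearMap ∘ₗ G ∘ₗ (siteEquiv P 0).toLinearMap

/-- `onVec G A = ofSite (G (toSite A))`. [cite: Balaban1982Higgs1, p.608] -/
theorem onVec_apply (G : Module.End ℝ (ScalarField P 0 P.d)) (A : HiggsLattice.VecField P 0) :
    onVec G A = ofSite (G (toSite A)) := rfl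

/-- `onVec` is additive in the operator. [cite: Balaban1982Higgs1, p.608] -/
theorem onVec_sub (G G' : Module.End ℝ (ScalarField P 0 P.d)) : onVec (G - G') = onVec G - onVec G' := by
  simp only [onVec, LinearMap.comp_sub, LinearMap.sub_comp]

/-- **The kernel of an operator in bond coordinates**: the matrix `K(b, b′)` with `(KA)(b) = Σ_{b′} K(b, b′)A(b′)` — the
unweighted kernel a `Matrix X X ℝ` of `B2Eq218Translation` stands for (`LinearMap.toMatrix'`).
[cite: Balaban1982Higgs2, (2.18) p.560] -/
def vecMat (G : Module.End ℝ (ScalarField P 0 P.d)) : Matrix (HiggsLattice.PBond P 0) (HiggsLattice.PBond P 0) ℝ :=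
  LinearMap.toMatrix' (onVec G)

/-- `vecMat G` acts as `G`: `vecMat G *ᵥ A = ofSite (G (toSite A))`. [cite: Balaban1982Higgs2, (2.18) p.560] -/
theorem vecMat_mulVec (G : Module.End ℝ (ScalarField P 0 P.d)) (A : HiggsLattice.VecField P 0) :
    vecMat G *ᵥ A = ofSite (G (toSite A)) := by
  rw [vecMat, LinearMap.toMatrix'_mulVec, onVec_apply]

/-- The matrix entry: `vecMat G b b′ = (G δ_{b′})(b)`, `δ_{b′}` the unit vector field at the component `b′`.
[cite: Balaban1982Higgs2, (2.18) p.560] -/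
theorem vecMat_apply (G : Module.End ℝ (ScalarField P 0 P.d)) (b b' : HiggsLattice.PBond P 0) :
    vecMat G b b' = G (toSite (Pi.single b' (1 : ℝ))) b.src b.dir := by
  rw [vecMat, LinearMap.toMatrix'_apply, onVec_apply]
  rfl

/-- `vecMat` of a difference. [cite: Balaban1982Higgs2, (2.19) p.560] -/
theorem vecMat_sub (G G' : Module.End ℝ (ScalarField P 0 P.d)) : vecMat (G - G') = vecMat G - vecMat G' := by
  rw [vecMat, vecMat, vecMat, onVec_sub, map_sub]

/-- The unit vector field at the component `b′`, as a site function, is supported at the site `b′₋`.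
[cite: Balaban1982Higgs1, p.608] -/
theorem toSite_single_apply_of_ne {b' : HiggsLattice.PBond P 0} {x : HiggsLattice.Site P 0} (hx : x ≠ b'.src) :
    toSite (Pi.single b' (1 : ℝ)) x = 0 := by
  ext μ
  have hb : (⟨x, μ⟩ : HiggsLattice.PBond P 0) ≠ b' := by
    rintro rfl
    exact hx rfl
  simp [toSite, Pi.single_apply, hb]

/-- The cut `Λ·δ_{b′}` is `δ_{b′}` when `b′₋ ∈ Λ`. [cite: Balaban1982Higgs1, (2.32) p.611] -/
theorem cutTo_toSite_single_of_mem {Λ : Finset (HiggsLattice.Site P 0)} {b' : HiggsLattice.PBond P 0} (hb' : b'.src ∈ Λ) :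
    cutTo Λ (toSite (Pi.single b' (1 : ℝ))) = toSite (Pi.single b' (1 : ℝ)) := by
  funext x
  by_cases hx : x ∈ Λ
  · exact cutTo_of_mem Λ _ hx
  · rw [cutTo_of_not_mem Λ _ hx, toSite_single_apply_of_ne]
    rintro rfl
    exact hx hb'

/-- The cut `Λ·δ_{b′}` vanishes when `b′₋ ∉ Λ`. [cite: Balaban1982Higgs1, (2.32) p.611] -/
theorem cutTo_toSite_single_of_not_mem {Λ : Finset (HiggsLattice.Site P 0)} {b' : HiggsLattice.PBond P 0}
    (hb' : b'.src ∉ Λ) : cutTo Λ (toSite (Pi.single b' (1 : ℝ))) = 0 := by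
  funext x
  by_cases hx : x ∈ Λ
  · rw [cutTo_of_mem Λ _ hx, toSite_single_apply_of_ne]
    · rfl
    · rintro rfl
      exact hb' hx
  · exact cutTo_of_not_mem Λ _ hx

/-! ## §2 The covariances of (2.18)/(2.19) for the VECTOR field (I p. 608: `N = d`, external field `0`) -/

/-- **`C^{(0)}` of (2.19) / (I.3.10)** as a kernel in bond coordinates: the matrix of the level-0 vector-field covariance
`(a(Lε)⁻²Q*Q + (−Δ^ε + msq))⁻¹` = `B1Eq230FluctCov.fluctCovA` at the trivial coupling `zeroCharge d`, external field `0`,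
whole torus, level `0` (= `HiggsFluctMeasure.fluctCov P msq a 0`, `covMat_eq_fluctCov`; `msq` ↤ μ₀², resp. μ₀²ε² on the
unit lattice, I (3.11)). [cite: Balaban1982Higgs1, (3.10) p.614] -/
def covMat (P : HiggsLattice.Params) (msq a : ℝ) : Matrix (HiggsLattice.PBond P 0) (HiggsLattice.PBond P 0) ℝ :=
  vecMat (fluctCovA (zeroCharge P.d) Finset.univ (0 : HiggsLattice.VecField P 0) msq a 0)

/-- **`C^{(0)}_{Λ₀}` of (2.18)**, *"the covariance with the Dirichlet boundary conditions outside Λ₀ introduced in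
Chap. I.2"*, as a kernel in bond coordinates: the matrix of the typer's (I.2.32) conditional covariance
`HiggsCondCov232.condCov232` at `N = d`, trivial coupling, external field `0`, level `0`, conditioning set `Λ₀ ⊂ T₁`.
[cite: Balaban1982Higgs2, (2.18) p.560] -/
def condCovMat (P : HiggsLattice.Params) (msq a : ℝ) (Λ₀ : Finset (HiggsLattice.Site P 0)) :
    Matrix (HiggsLattice.PBond P 0) (HiggsLattice.PBond P 0) ℝ :=
  vecMat (condCov232 (zeroCharge P.d) Finset.univ (0 : HiggsLattice.VecField P 0) msq a 0 Λ₀)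

/-- `C^{(0)}` IS the typer's vector-field fluctuation covariance `HiggsFluctMeasure.fluctCov P msq a 0` (I p. 608 *"N = d
and … A = 0"*, `B1Eq230FluctCov.fluctCovA_zero_field`). [cite: Balaban1982Higgs1, (2.30) p.611] -/
theorem covMat_eq_fluctCov (msq a : ℝ) : covMat P msq a = vecMat (HiggsFluctMeasure.fluctCov P msq a 0) := by
  rw [covMat, fluctCovA_zero_field]

/-- **No conditioning gives back `C^{(0)}`**: `C^{(0)}_{T₁} = C^{(0)}` (`HiggsCondCov232.condCov232_univ`).
[cite: Balaban1982Higgs1, (2.32) p.611] -/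
theorem condCovMat_univ (msq a : ℝ) : condCovMat P msq a Finset.univ = covMat P msq a := by
  rw [condCovMat, condCov232_univ, covMat]

/-- **(I.3.11) on the carrier: `(C^{(0)})⁻¹ = aL⁻²Q*Q + (−Δ + μ₀²ε²)`** — the operator the typer's `fluctCovA` inverts
at `N = d`, external field `0`, level `0` is `a(Lε)⁻²·Q*Q + (−Δ^ε + msq)` with `Q*`, `Q` the one-step adjoint pair of
`B1Eq27StepAdjoint` and `−Δ^ε` = `HiggsCovariance.covLaplacianN` at the trivial coupling (definitional unfolding of p35's
`precOpA`/`blockProjA`/`deltaKA 0`). [cite: Balaban1982Higgs1, (3.11) p.614] -/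
theorem precOp_vec_eq (msq a : ℝ) :
    precOpA (zeroCharge P.d) Finset.univ (0 : HiggsLattice.VecField P 0) msq a 0
      = (a * (P.mesh 1)⁻¹ ^ 2) •
          (avgQAdjLin (zeroCharge P.d) (0 : HiggsLattice.VecField P 0) 0
            ∘ₗ avgQLin (zeroCharge P.d) (0 : HiggsLattice.VecField P 0) 0)
        + (HiggsCovariance.covLaplacianN (zeroCharge P.d) Finset.univ (0 : HiggsLattice.VecField P 0)
            + msq • LinearMap.id) := rfl

/-- `C^{(0)}` is the (ring) inverse of that operator (p35's `fluctCovA` = `Ring.inverse precOpA`; a genuine two-sided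
inverse for `msq > 0`, `a > 0`, `L > 1` by `B1Eq230FluctCovPos`/`HiggsCondCov232`). [cite: Balaban1982Higgs1, (3.11) p.614] -/
theorem cov_vec_eq_inverse (msq a : ℝ) :
    fluctCovA (zeroCharge P.d) Finset.univ (0 : HiggsLattice.VecField P 0) msq a 0
      = Ring.inverse (precOpA (zeroCharge P.d) Finset.univ (0 : HiggsLattice.VecField P 0) msq a 0 :
          Module.End ℝ (ScalarField P 0 P.d)) := rfl

/-- Dirichlet boundary conditions, output side: `C^{(0)}_{Λ₀}(b, b′) = 0` for `b₋ ∉ Λ₀`. [cite: Balaban1982Higgs2, (2.18) p.560] -/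
theorem condCovMat_eq_zero_of_left {msq a : ℝ} {Λ₀ : Finset (HiggsLattice.Site P 0)} {b b' : HiggsLattice.PBond P 0}
    (hb : b.src ∉ Λ₀) : condCovMat P msq a Λ₀ b b' = 0 := by
  rw [condCovMat, vecMat_apply, condCov232_apply_of_not_mem _ _ _ _ _ _ _ _ hb]
  rfl

/-- Dirichlet boundary conditions, input side: `C^{(0)}_{Λ₀}(b, b′) = 0` for `b′₋ ∉ Λ₀`. [cite: Balaban1982Higgs2, (2.18) p.560] -/
theorem condCovMat_eq_zero_of_right {msq a : ℝ} {Λ₀ : Finset (HiggsLattice.Site P 0)} {b b' : HiggsLattice.PBond P 0}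
    (hb' : b'.src ∉ Λ₀) : condCovMat P msq a Λ₀ b b' = 0 := by
  rw [condCovMat, vecMat_apply, ← condCov232_cutTo, cutTo_toSite_single_of_not_mem hb', map_zero]
  rfl

/-- **The support fact `hCΛ` of `B2Eq218Translation.eq219`, DISCHARGED for the concrete `C^{(0)}_{Λ₀}`**: a non-zero
kernel entry has both components over Λ₀. [cite: Balaban1982Higgs2, (2.19) p.560] -/
theorem condCovMat_support (msq a : ℝ) (Λ₀ : Finset (HiggsLattice.Site P 0)) :
    ∀ b b' : HiggsLattice.PBond P 0, condCovMat P msq a Λ₀ b b' ≠ 0 → b ∈ bondsOver Λ₀ ∧ b' ∈ bondsOver Λ₀ := by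
  intro b b' h
  rw [mem_bondsOver, mem_bondsOver]
  by_contra hne
  rcases not_and_or.1 hne with hb | hb'
  · exact h (condCovMat_eq_zero_of_left hb)
  · exact h (condCovMat_eq_zero_of_right hb')

/-- **r02's `deltaC` IS the typer's (I.2.35)**: the kernel `δC^{(0)}_{Λ₀}` on Λ₀ × Λ₀ (extended by zero, THE READING of
`B2Eq218Translation`) is the bond-coordinate matrix of the restriction `(δC^{(0)}_{Λ₀})↾_{Λ₀} = Λ₀(C^{(0)}_{Λ₀} − C^{(0)})Λ₀`
of `HiggsCondCov232.deltaCov235` (`restrictOp`, I p. 611). [cite: Balaban1982Higgs1, (2.35) p.611] -/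
theorem deltaC_eq_vecMat_restrictOp_deltaCov235 (msq a : ℝ) (Λ₀ : Finset (HiggsLattice.Site P 0)) :
    deltaC (bondsOver Λ₀) (condCovMat P msq a Λ₀) (covMat P msq a)
      = vecMat (restrictOp Λ₀ (deltaCov235 (zeroCharge P.d) Finset.univ (0 : HiggsLattice.VecField P 0) msq a 0 Λ₀)) := by
  ext b b'
  rw [vecMat_apply, restrictOp_apply]
  simp only [deltaC, mem_bondsOver]
  by_cases hb : b.src ∈ Λ₀
  · by_cases hb' : b'.src ∈ Λ₀
    · rw [if_pos ⟨hb, hb'⟩, cutTo_of_mem Λ₀ _ hb, cutTo_toSite_single_of_mem hb', deltaCov235, LinearMap.sub_apply,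
        condCovMat, covMat, vecMat_apply, vecMat_apply]
      rfl
    · rw [if_neg (fun h => hb' h.2), cutTo_toSite_single_of_not_mem hb', map_zero, cutTo_of_mem Λ₀ _ hb]
      rfl
  · rw [if_neg (fun h => hb h.1), cutTo_of_not_mem Λ₀ _ hb]
    rfl

/-! ## §3 (2.18) on the carrier -/

/-- **(2.18)** p. 560, verbatim: *"A = A′ + aL⁻²C^{(0)}_{Λ₀}Q*B"* — written with the CONCRETE operators: the vector field
`A′` plus `a(Lε)⁻²` times the typer's conditional covariance `C^{(0)}_{Λ₀}` (`condCov232` at `N = d`, `A = 0`, level 0)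
applied to `Q*B`, `Q*` = `B1Eq27StepAdjoint.avgQAdjLin` (the adjoint of the block averaging for (I.1.5)), the block
vector field `B` on `T*′₁` read as an `ℝ^d`-valued site function (`toSite`). [cite: Balaban1982Higgs2, (2.18) p.560] -/
def transl218C (msq a : ℝ) (Λ₀ : Finset (HiggsLattice.Site P 0)) (A' : HiggsLattice.VecField P 0)
    (B : HiggsLattice.VecField P 1) : HiggsLattice.VecField P 0 :=
  A' + (a * (P.mesh 1)⁻¹ ^ 2) •
    ofSite (condCov232 (zeroCharge P.d) Finset.univ (0 : HiggsLattice.VecField P 0) msq a 0 Λ₀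
      (avgQAdjLin (zeroCharge P.d) (0 : HiggsLattice.VecField P 0) 0 (toSite B)))

/-- With `w = 1`, r02's `Q*` kernel pulls the block field back along the block map: `(Q*B)(b) = B(blk b)`.
[cite: Balaban1982Higgs2, (2.19) p.561] -/
theorem qstar_one_mulVec (B : HiggsLattice.VecField P 1) : qstar 1 blk *ᵥ B = fun b => B (blk b) := by
  rw [qstar_mulVec_eq]
  funext b
  rw [one_mul]

/-- **`w = 1` is print's `Q*`**: the pull-back `b ↦ B(blk b)`, read as a site function, IS the typer's adjoint averaging
operator `Q*` (`B1Eq27StepAdjoint.avgQAdjLin`, adjoint of `Q` for the scalar products (I.1.5) — `siteInner_avgQLin`) at the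
trivial coupling: `(Q*B)(x) = B(y_x)`. [cite: Balaban1982Higgs1, p.608] -/
theorem toSite_pullback_eq_avgQAdjLin (B : HiggsLattice.VecField P 1) :
    toSite (fun b => B (blk b)) = avgQAdjLin (zeroCharge P.d) (0 : HiggsLattice.VecField P 0) 0 (toSite B) := by
  funext x
  rw [avgQAdjLin_apply, zeroCharge_U, star_one, one_apply_eq_self]
  rfl

/-- **(2.18) concrete = (2.18) schematic**: `transl218C` IS r02's `B2Eq218Translation.transl218` at the instance
`c = a(Lε)⁻²`, `w = 1`, `CΛ = condCovMat`, `blk`. [cite: Balaban1982Higgs2, (2.18) p.560] -/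
theorem transl218C_eq (msq a : ℝ) (Λ₀ : Finset (HiggsLattice.Site P 0)) (A' : HiggsLattice.VecField P 0)
    (B : HiggsLattice.VecField P 1) :
    transl218C msq a Λ₀ A' B = transl218 (a * (P.mesh 1)⁻¹ ^ 2) 1 (condCovMat P msq a Λ₀) blk A' B := by
  rw [transl218, condCovMat, vecMat_mulVec, qstar_one_mulVec, toSite_pullback_eq_avgQAdjLin, transl218C]

/-- … hence IS part I's (I.3.10) `B1Sect3Statements.transl310` with `C^{(0)}_{Λ₀}` (r02's `transl218_eq_transl310`).
[cite: Balaban1982Higgs1, (3.10) p.614] -/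
theorem transl218C_eq_transl310 (msq a : ℝ) (Λ₀ : Finset (HiggsLattice.Site P 0)) (A' : HiggsLattice.VecField P 0)
    (B : HiggsLattice.VecField P 1) :
    transl218C msq a Λ₀ A' B = B1Sect3Statements.transl310 (a * (P.mesh 1)⁻¹ ^ 2) (condCovMat P msq a Λ₀).mulVecLin
      (qstar (1 : ℝ) blk).mulVecLin A' B := by
  rw [transl218C_eq, transl218_eq_transl310]

/-- **(I.3.10) on the carrier** = (2.18) without conditioning (`Λ₀ = T₁`): `A = A′ + a(Lε)⁻²C^{(0)}Q*B` with the
vector-field covariance `C^{(0)}` = `fluctCovA (zeroCharge d) T 0 msq a 0`. [cite: Balaban1982Higgs1, (3.10) p.614] -/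
theorem transl218C_univ (msq a : ℝ) (A' : HiggsLattice.VecField P 0) (B : HiggsLattice.VecField P 1) :
    transl218C msq a Finset.univ A' B = A' + (a * (P.mesh 1)⁻¹ ^ 2) •
      ofSite (fluctCovA (zeroCharge P.d) Finset.univ (0 : HiggsLattice.VecField P 0) msq a 0
        (avgQAdjLin (zeroCharge P.d) (0 : HiggsLattice.VecField P 0) 0 (toSite B))) := by
  rw [transl218C, condCov232_univ]

/-- (I.3.10) on the carrier in r02's coordinates: `transl218 c 1 C blk`. [cite: Balaban1982Higgs1, (3.10) p.614] -/
theorem transl218C_univ_eq (msq a : ℝ) (A' : HiggsLattice.VecField P 0) (B : HiggsLattice.VecField P 1) :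
    transl218C msq a Finset.univ A' B = transl218 (a * (P.mesh 1)⁻¹ ^ 2) 1 (covMat P msq a) blk A' B := by
  rw [transl218C_eq, condCovMat_univ]

/-- The coefficient on the UNIT lattice (`P.unitAt 0`: spacing `1` at level `0`, II §2 after (I.3.7)): `a·(L·1)⁻² = aL⁻²`,
print's letter. [cite: Balaban1982Higgs2, (2.18) p.560] -/
theorem coeff_unitAt (a : ℝ) : a * ((P.unitAt 0).mesh 1)⁻¹ ^ 2 = a * ((P.L : ℝ) ^ 2)⁻¹ := by
  have h : (P.unitAt 0).mesh 1 = (P.L : ℝ) := by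
    simp [HiggsLattice.Params.unitAt, HiggsLattice.Params.mesh]
  rw [h, inv_pow]

/-- The p. 561 kernel at `w = 1`, summed without weight: `(ζC^{(0)}Q*B)(b) = Σ_{b′} ζ(b, blk b′) C^{(0)}(b, b′) B(blk b′)` —
print's `Σ_{y∈T′₁} L^d · ζ(x,y)L^{−d}Σ_{x′∈B(y)}C^{(0)}(x,x′) · B(y)` with the `L^{±d}` cancelled.
[cite: Balaban1982Higgs2, (2.19) p.561] -/
theorem zetaCQ_one_mulVec (ζ : Matrix (HiggsLattice.PBond P 0) (HiggsLattice.PBond P 1) ℝ)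
    (C : Matrix (HiggsLattice.PBond P 0) (HiggsLattice.PBond P 0) ℝ) (B : HiggsLattice.VecField P 1)
    (b : HiggsLattice.PBond P 0) :
    (zetaCQ ζ C 1 blk *ᵥ B) b = ∑ b', ζ b (blk b') * C b b' * B (blk b') := by
  rw [zetaCQ_mulVec]
  refine Finset.sum_congr rfl fun b' _ => ?_
  rw [one_mul]

/-! ## §4 (2.19) on the carrier -/

/-- `θ₁` (a function on the sites of `T₁`) acting on components: `θ(⟨x, x+e_μ⟩) = θ₁(x)`.
[cite: Balaban1982Higgs2, (2.19) p.560] -/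
def thetaB (θ₁ : HiggsLattice.Site P 0 → ℝ) : HiggsLattice.PBond P 0 → ℝ := fun b => θ₁ b.src

/-- The distance entering `ζ(x, y)`, `x ∈ T₁`, `y ∈ T′₁` (p. 561): the sup-distance (I.1.3) `|x − y|` between the site of
the component and the point `y ∈ T′₁ ⊂ T₁` (`HiggsLattice.emb`, I (1.19)) of the block component.
[cite: Balaban1982Higgs2, (2.19) p.561] -/
def bondDist (b : HiggsLattice.PBond P 0) (y : HiggsLattice.PBond P 1) : ℝ :=
  (HiggsLattice.Site.tdist b.src (HiggsLattice.emb y.src) : ℝ)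

/-- **ζ of p. 561 on the carrier**: r02's `zetaOfDist` (= 1 if `|x − y| ≤ ½r`, = 0 if `|x − y| > ½r`) of `bondDist`.
[cite: Balaban1982Higgs2, (2.19) p.561] -/
def zeta1 (r : ℝ) : Matrix (HiggsLattice.PBond P 0) (HiggsLattice.PBond P 1) ℝ :=
  zetaOfDist bondDist r

/-- `ζ(x, y) = 1 if |x − y| ≦ ½r(ε)` on the carrier. [cite: Balaban1982Higgs2, (2.19) p.561] -/
theorem zeta1_eq_one {r : ℝ} {b : HiggsLattice.PBond P 0} {y : HiggsLattice.PBond P 1} (h : bondDist b y ≤ r / 2) :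
    zeta1 r b y = 1 :=
  zetaOfDist_eq_one h

/-- `ζ(x, y) = 0 if |x − y| > ½r(ε)` on the carrier. [cite: Balaban1982Higgs2, (2.19) p.561] -/
theorem zeta1_eq_zero {r : ℝ} {b : HiggsLattice.PBond P 0} {y : HiggsLattice.PBond P 1} (h : r / 2 < bondDist b y) :
    zeta1 r b y = 0 :=
  zetaOfDist_eq_zero h

/-- **The hypothesis `hζ` of `eq219` from the printed geometry, on the carrier**: if `θ₁` is supported at sup-distance
`> ½r` from `Λ₀ᶜ = T₁ ∖ B(Λ′₀)` (print: supp θ₁ ⊂ the M-slice around Λ₂ ⊂ Λ₁, and dist(Λ₁, Λ₀ᶜ) > r(ε) > ½r(ε) + M by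
(2.8)), then on supp θ₁ the cut-off `ζ(x, ·)` only reaches block points of Λ′₀ (r02's `zeta_reach_of_dist`).
[cite: Balaban1982Higgs2, (2.19) pp.560–561] -/
theorem zeta1_reach (hK : 0 < P.K) {r : ℝ} {Λ₀' : Finset (HiggsLattice.Site P 1)} {θ₁ : HiggsLattice.Site P 0 → ℝ}
    (hfar : ∀ x, θ₁ x ≠ 0 → ∀ z, z ∉ HiggsLattice.blockSet Λ₀' → r / 2 < (HiggsLattice.Site.tdist x z : ℝ)) :
    ∀ b y, thetaB θ₁ b ≠ 0 → zeta1 r b y ≠ 0 → y ∈ bondsOver Λ₀' := by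
  refine zeta_reach_of_dist fun b y hb hy => ?_
  have hy' : HiggsLattice.emb y.src ∉ HiggsLattice.blockSet Λ₀' := by
    rw [HiggsLattice.mem_blockSet, B1Eq116PrimeOperation.blockOf_emb hK]
    rwa [mem_bondsOver] at hy
  exact hfar b.src hb _ hy'

/-- `supp θ₁ ⊂ Λ₀` follows from the distance hypothesis when `r ≥ 0` (take `z = x`). [cite: Balaban1982Higgs2, (2.19) p.560] -/
theorem support_of_far {r : ℝ} (hr : 0 ≤ r) {Λ₀' : Finset (HiggsLattice.Site P 1)} {θ₁ : HiggsLattice.Site P 0 → ℝ}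
    (hfar : ∀ x, θ₁ x ≠ 0 → ∀ z, z ∉ HiggsLattice.blockSet Λ₀' → r / 2 < (HiggsLattice.Site.tdist x z : ℝ)) :
    ∀ x, θ₁ x ≠ 0 → x ∈ HiggsLattice.blockSet Λ₀' := by
  intro x hx
  by_contra hxΛ
  have h := hfar x hx x hxΛ
  have h0 : (HiggsLattice.Site.tdist x x : ℝ) = 0 := by
    simp [HiggsLattice.Site.tdist]
  rw [h0] at h
  linarith

/-- **(2.19) ON THE CARRIER** (p. 560 [PDF 6]): `A = B̃^{(1)} + A″` for the concrete translated field (2.18) — r02's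
`btilde`/`adprime` at the instance (`c = a(Lε)⁻²`, `w = 1`, `CΛ = C^{(0)}_{Λ₀}`, `C = C^{(0)}` of the VECTOR field,
`Λ₀ = B(Λ′₀)`, `θ = θ₁` on components, `ζ = zeta1 r`), for EVERY `θ₁` supported in Λ₀ (`hθ`) at sup-distance `> ½r` from
`Λ₀ᶜ` (`hfar`) — all four support facts of `B2Eq218Translation.eq219` discharged (`condCovMat_support`,
`mem_bondsOver_blockSet_iff`, `hθ`, `zeta1_reach`); level `0 < K`. [cite: Balaban1982Higgs2, (2.19) p.560] -/
theorem eq219_concrete (hK : 0 < P.K) (msq a r : ℝ) (Λ₀' : Finset (HiggsLattice.Site P 1))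
    {θ₁ : HiggsLattice.Site P 0 → ℝ} (hθ : ∀ x, θ₁ x ≠ 0 → x ∈ HiggsLattice.blockSet Λ₀')
    (hfar : ∀ x, θ₁ x ≠ 0 → ∀ z, z ∉ HiggsLattice.blockSet Λ₀' → r / 2 < (HiggsLattice.Site.tdist x z : ℝ))
    (A' : HiggsLattice.VecField P 0) (B : HiggsLattice.VecField P 1) :
    transl218C msq a (HiggsLattice.blockSet Λ₀') A' B =
      btilde (a * (P.mesh 1)⁻¹ ^ 2) 1 (condCovMat P msq a (HiggsLattice.blockSet Λ₀')) (covMat P msq a) blk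
          (thetaB θ₁) (zeta1 r) A' B
        + adprime (a * (P.mesh 1)⁻¹ ^ 2) 1 (bondsOver (HiggsLattice.blockSet Λ₀')) (bondsOver Λ₀')
          (condCovMat P msq a (HiggsLattice.blockSet Λ₀')) (covMat P msq a) blk (thetaB θ₁) (zeta1 r) A' B := by
  rw [transl218C_eq]
  exact eq219 A' B (condCovMat_support msq a _) (mem_bondsOver_blockSet_iff Λ₀')
    (fun b hb => (mem_bondsOver _ b).2 (hθ b.src hb)) (zeta1_reach hK hfar)

/-- (2.19) on the carrier with the distance hypothesis alone (`r ≥ 0`; `support_of_far`). [cite: Balaban1982Higgs2, (2.19) p.560] -/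
theorem eq219_concrete' (hK : 0 < P.K) (msq a : ℝ) {r : ℝ} (hr : 0 ≤ r) (Λ₀' : Finset (HiggsLattice.Site P 1))
    {θ₁ : HiggsLattice.Site P 0 → ℝ}
    (hfar : ∀ x, θ₁ x ≠ 0 → ∀ z, z ∉ HiggsLattice.blockSet Λ₀' → r / 2 < (HiggsLattice.Site.tdist x z : ℝ))
    (A' : HiggsLattice.VecField P 0) (B : HiggsLattice.VecField P 1) :
    transl218C msq a (HiggsLattice.blockSet Λ₀') A' B =
      btilde (a * (P.mesh 1)⁻¹ ^ 2) 1 (condCovMat P msq a (HiggsLattice.blockSet Λ₀')) (covMat P msq a) blk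
          (thetaB θ₁) (zeta1 r) A' B
        + adprime (a * (P.mesh 1)⁻¹ ^ 2) 1 (bondsOver (HiggsLattice.blockSet Λ₀')) (bondsOver Λ₀')
          (condCovMat P msq a (HiggsLattice.blockSet Λ₀')) (covMat P msq a) blk (thetaB θ₁) (zeta1 r) A' B :=
  eq219_concrete hK msq a r Λ₀' (support_of_far hr hfar) hfar A' B

/-- **(2.19) for the original integration variable** on the carrier: with `A′ := A − a(Lε)⁻²C^{(0)}_{Λ₀}Q*B` (the inverse
of (2.18)), `A = B̃^{(1)} + A″` (r02's `eq219_transl` at the instance). [cite: Balaban1982Higgs2, (2.18)–(2.19) p.560] -/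
theorem eq219_concrete_transl (hK : 0 < P.K) (msq a r : ℝ) (Λ₀' : Finset (HiggsLattice.Site P 1))
    {θ₁ : HiggsLattice.Site P 0 → ℝ} (hθ : ∀ x, θ₁ x ≠ 0 → x ∈ HiggsLattice.blockSet Λ₀')
    (hfar : ∀ x, θ₁ x ≠ 0 → ∀ z, z ∉ HiggsLattice.blockSet Λ₀' → r / 2 < (HiggsLattice.Site.tdist x z : ℝ))
    (A : HiggsLattice.VecField P 0) (B : HiggsLattice.VecField P 1) :
    A = btilde (a * (P.mesh 1)⁻¹ ^ 2) 1 (condCovMat P msq a (HiggsLattice.blockSet Λ₀')) (covMat P msq a) blk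
          (thetaB θ₁) (zeta1 r)
          (A - (a * (P.mesh 1)⁻¹ ^ 2) • (condCovMat P msq a (HiggsLattice.blockSet Λ₀') *ᵥ (qstar 1 blk *ᵥ B))) B
        + adprime (a * (P.mesh 1)⁻¹ ^ 2) 1 (bondsOver (HiggsLattice.blockSet Λ₀')) (bondsOver Λ₀')
          (condCovMat P msq a (HiggsLattice.blockSet Λ₀')) (covMat P msq a) blk (thetaB θ₁) (zeta1 r)
          (A - (a * (P.mesh 1)⁻¹ ^ 2) • (condCovMat P msq a (HiggsLattice.blockSet Λ₀') *ᵥ (qstar 1 blk *ᵥ B))) B :=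
  eq219_transl A B (condCovMat_support msq a _) (mem_bondsOver_blockSet_iff Λ₀')
    (fun b hb => (mem_bondsOver _ b).2 (hθ b.src hb)) (zeta1_reach hK hfar)

/-! ## §5 Existence of `C^{(0)}_{Λ₀}` for the vector field (I p. 611 *"It is so"*, `μ₀² > 0`) -/

/-- **`C^{(0)}_{Λ₀}` of (2.18) exists and inverts the restricted precision** for the vector field: with `m² ↦ μ₀² > 0`,
`a > 0`, `L > 1`, `((a(Lε)⁻²Q*Q + (−Δ^ε + μ₀²))↾_{Λ₀})·C^{(0)}_{Λ₀} = Λ₀` — the typer's `restrictOp_precOpA_mul_condCov232`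
at `N = d`, external field `0` (nothing new; recorded so that the instance carries its existence statement).
[cite: Balaban1982Higgs1, (2.32) p.611] -/
theorem condCov_vec_inverse {msq a : ℝ} (hmsq : 0 < msq) (ha : 0 < a) (hL : 1 < (P.L : ℝ))
    (Λ₀ : Finset (HiggsLattice.Site P 0)) :
    restrictOp Λ₀ (precOpA (zeroCharge P.d) Finset.univ (0 : HiggsLattice.VecField P 0) msq a 0)
        * condCov232 (zeroCharge P.d) Finset.univ (0 : HiggsLattice.VecField P 0) msq a 0 Λ₀
      = (cutToLin Λ₀ : Module.End ℝ (ScalarField P 0 P.d)) :=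
  restrictOp_precOpA_mul_condCov232 _ _ _ hmsq ha hL (Nat.zero_le _) Λ₀

end

end Literature.MathematicalPhysics.QuantumFieldTheory.Balaban1983to89.B2Eq218Concrete
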